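import Mathlib
import HarnessLib
import Summits.Ventures.LatticeQCDFlow.Scoring.RegenerativeMedianOfGroupsChernoff
import Summits.Ventures.LatticeQCDFlow.Scoring.RegenerativeEstimatorSigma
import Summits.Ventures.LatticeQCDFlow.Scoring.SampleMedianDeterministic

/-!
# Median of tour groups at the CLT scale, CHERNOFF form: `q = 4(e σ²_f/s² + 1 − e)/m ≤ 1/2` suffices,
# with `P(#bad ≥ K/2) ≤ (2√(q(1−q)))^K`, and the literal median statement

HONEST FRAMING: exact (Metropolis-corrected) sampling algorithms for lattice gauge theory;
figures of merit are autocorrelation/cost numbers at stated couplings and volumes; no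
continuum-physics claim.

Venture `LatticeQCDFlow` (cell pub-lqcd), topic `Scoring`; FANOUT row 8 (`s0-cpn-nemc`, GEN-18).
NEW WORK of the cell, not a published result; no definition is introduced.  The CLT-scale instance
of `Scoring/RegenerativeMedianOfGroupsChernoff.lean` (per-group bound from
`Scoring/RegenerativeEstimatorSigma.lean`: the group-of-`m`-tours estimate misses `π(f)` by `≥ s`
with probability `≤ q := 4(e σ²_f/s² + (1 − e))/m` from every initial law), and its literal-median
form via `Scoring/SampleMedianDeterministic.lean`.  Compared with
`Scoring/RegenerativeMedianOfGroupsSigma.lean` / `Scoring/RegenerativeMedianSigma.lean` (GEN-17: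
`q ≤ 1/4 ⇒ e^{−K/8}`): groups HALF as long suffice (`q ≤ 1/2`, i.e. `m ≥ 8(e σ²_f/s² + 1 − e)`), and
at equal `q` the rate `(4q(1−q))^{K/2}` is sharper.  Printed counterpart NAMED ONLY: median-of-means
(Nemirovsky–Yudin 1983; Devroye–Lerasle–Lugosi–Oliveira 2016) — nothing is cited as a fact.

## Content (`π` invariant; `0 < ε < 1`; `|f| ≤ C` measurable; any initial law; `m ≥ 1`; `s > 0`)

* **`regenerative_medianOfGroups_chernoff_sigma`** — `q ≤ 1/2 ⇒ P(#bad ≥ K/2) ≤ (2√(q(1−q)))^K`;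
* **`regenerative_median_chernoff_sigma`** — for any pointwise median `M` of the `K` group
  estimates, `P(s ≤ |M − π f|) ≤ (2√(q(1−q)))^K`.

NOT CLAIMED: optimal constants in `q`; a CLT; any `ε` of a concrete sampler.
-/

noncomputable section

namespace Summit.Ventures.LatticeQCDFlow.Scoring

open MeasureTheory ProbabilityTheory Filter Finset Preorder Literature.Probability.MarkovChains
open scoped ENNReal

section ChernoffSigma

variable {Ω : Type*} [MeasurableSpace Ω]
  {κ : Kernel Ω Ω} [IsMarkovKernel κ] {ν : Measure Ω} [IsProbabilityMeasure ν] {ε : ℝ≥0∞}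
  {hmin : ∀ x {B : Set Ω}, MeasurableSet B → ε * ν B ≤ κ x B}
  (κs : Kernel (Ω × Bool) (Ω × Bool)) [IsMarkovKernel κs]
  (μs : Measure (Ω × Bool)) [IsProbabilityMeasure μs]

/-- **MEDIAN OF TOUR GROUPS AT THE CLT SCALE, CHERNOFF FORM.**  `π` invariant, `κ(x, ·) ≥ ε ν` with
`0 < ε < 1`, `|f| ≤ C` measurable, any initial law, `m ≥ 1`, `s > 0`; with
`q = 4 (e σ²_f/s² + (1 − e))/m ≤ 1/2`: for every `K`, `P((K : ℝ)/2 ≤ Σ_{k<K} χ_k) ≤ (2√(q(1−q)))^K`. -/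
theorem regenerative_medianOfGroups_chernoff_sigma {π : Measure Ω} [IsProbabilityMeasure π]
    (hπ : Kernel.Invariant κ π) (hε0 : 0 < ε) (hε : ε < 1)
    (hκs : ∀ p, κs p = (ε • ν).map (fun y : Ω => (y, true))
      + ((1 - ε) • Doeblin.residualKernel κ ν ε hmin p.1).map (fun y : Ω => (y, false)))
    {f : Ω → ℝ} (hf : Measurable f) {C : ℝ} (hC : ∀ x, |f x| ≤ C) {m : ℕ} (hm : 0 < m)
    {s : ℝ} (hs : 0 < s)
    (hq : 4 * (ε.toReal * ((∫ y, (f y - ∫ z, f z ∂π) ^ 2 ∂π)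
          + 2 * ∑' k, ∫ y, (f y - ∫ z, f z ∂π) * (kop κ)^[k + 1] (fun y => f y - ∫ z, f z ∂π) y ∂π) / s ^ 2 + (1 - ε.toReal)) / m ≤ 1 / 2) (K : ℕ) :
    (Kernel.trajMeasure (X := fun _ : ℕ => Ω × Bool) μs
        (fun n : ℕ => κs.comap (fun h : (i : ↥(Finset.Iic n)) → Ω × Bool =>
          h ⟨n, Finset.mem_Iic.2 le_rfl⟩) (measurable_pi_apply _))).real
      {x | (K : ℝ) / 2 ≤ ∑ k ∈ Finset.range K,
        (if s ≤ |(∑ i ∈ Finset.range m, (∑' u, (if (∑ s ∈ Finset.range u, (if (x (s + 1)).2 then (1 : ℕ) else 0)) = k * (m + 1) + i + 1 then (1 : ℝ) else 0) * f (x u).1)) / (∑ i ∈ Finset.range m, (∑' u, (if (∑ s ∈ Finset.range u, (if (x (s + 1)).2 then (1 : ℕ) else 0)) = k * (m + 1) + i + 1 then (1 : ℝ) else 0)))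
            - ∫ z, f z ∂π| then (1 : ℝ) else 0)}
      ≤ (2 * Real.sqrt (4 * (ε.toReal * ((∫ y, (f y - ∫ z, f z ∂π) ^ 2 ∂π)
          + 2 * ∑' k, ∫ y, (f y - ∫ z, f z ∂π) * (kop κ)^[k + 1] (fun y => f y - ∫ z, f z ∂π) y ∂π) / s ^ 2 + (1 - ε.toReal)) / m
          * (1 - 4 * (ε.toReal * ((∫ y, (f y - ∫ z, f z ∂π) ^ 2 ∂π)
          + 2 * ∑' k, ∫ y, (f y - ∫ z, f z ∂π) * (kop κ)^[k + 1] (fun y => f y - ∫ z, f z ∂π) y ∂π) / s ^ 2 + (1 - ε.toReal)) / m))) ^ K := by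
  have he0 : 0 < ε.toReal := ENNReal.toReal_pos hε0.ne' (ne_top_of_lt hε)
  have he1 : ε.toReal < 1 := by
    have := (ENNReal.toReal_lt_toReal (ne_top_of_lt hε) ENNReal.one_ne_top).2 hε
    rwa [ENNReal.toReal_one] at this
  have hσ := asymptoticVariance_nonneg_minorised (κ := κ) (ν := ν) hπ hmin hε0 hε hf hC
  have hm0 : (0 : ℝ) < m := Nat.cast_pos.2 hm
  have hq0 : 0 < 4 * (ε.toReal * ((∫ y, (f y - ∫ z, f z ∂π) ^ 2 ∂π)
          + 2 * ∑' k, ∫ y, (f y - ∫ z, f z ∂π) * (kop κ)^[k + 1] (fun y => f y - ∫ z, f z ∂π) y ∂π) / s ^ 2 + (1 - ε.toReal)) / m := by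
    have h1 : 0 < 1 - ε.toReal := by linarith
    have h2 : 0 ≤ ε.toReal * ((∫ y, (f y - ∫ z, f z ∂π) ^ 2 ∂π)
          + 2 * ∑' k, ∫ y, (f y - ∫ z, f z ∂π) * (kop κ)^[k + 1] (fun y => f y - ∫ z, f z ∂π) y ∂π) / s ^ 2 := by positivity
    positivity
  exact regenerative_medianOfGroups_of_groupBound_chernoff κs μs (κ := κ) (ν := ν) (hmin := hmin) hε0
    hε hκs hf m hq0 hq (fun μ' _ => regenerative_estimator_confidence_sigma κs μ' (κ := κ) (ν := ν)
      (hmin := hmin) hπ hε0 hε hκs hf hC hm hs) K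

/-- **THE MEDIAN OF THE TOUR-GROUP ESTIMATES IS `s`-CLOSE, CHERNOFF FORM.**  With `M` any function of
the path that is, at every path, a median of the group estimates `A_0, …, A_{K−1}`, and
`q = 4(e σ²_f/s² + (1 − e))/m ≤ 1/2`: `P(s ≤ |M − π(f)|) ≤ (2√(q(1−q)))^K`. -/
theorem regenerative_median_chernoff_sigma {π : Measure Ω} [IsProbabilityMeasure π]
    (hπ : Kernel.Invariant κ π) (hε0 : 0 < ε) (hε : ε < 1)
    (hκs : ∀ p, κs p = (ε • ν).map (fun y : Ω => (y, true))
      + ((1 - ε) • Doeblin.residualKernel κ ν ε hmin p.1).map (fun y : Ω => (y, false)))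
    {f : Ω → ℝ} (hf : Measurable f) {C : ℝ} (hC : ∀ x, |f x| ≤ C) {m : ℕ} (hm : 0 < m)
    {s : ℝ} (hs : 0 < s)
    (hq : 4 * (ε.toReal * ((∫ y, (f y - ∫ z, f z ∂π) ^ 2 ∂π)
          + 2 * ∑' k, ∫ y, (f y - ∫ z, f z ∂π) * (kop κ)^[k + 1] (fun y => f y - ∫ z, f z ∂π) y ∂π) / s ^ 2 + (1 - ε.toReal)) / m ≤ 1 / 2) (K : ℕ)
    (M : (ℕ → Ω × Bool) → ℝ)
    (hlo : ∀ x, (K : ℝ) / 2 ≤ ∑ k ∈ Finset.range K, (if M x ≤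
        (∑ i ∈ Finset.range m, (∑' u, (if (∑ s ∈ Finset.range u, (if (x (s + 1)).2 then (1 : ℕ) else 0)) = k * (m + 1) + i + 1 then (1 : ℝ) else 0) * f (x u).1)) / (∑ i ∈ Finset.range m, (∑' u, (if (∑ s ∈ Finset.range u, (if (x (s + 1)).2 then (1 : ℕ) else 0)) = k * (m + 1) + i + 1 then (1 : ℝ) else 0)))
        then (1 : ℝ) else 0))
    (hhi : ∀ x, (K : ℝ) / 2 ≤ ∑ k ∈ Finset.range K, (if
        (∑ i ∈ Finset.range m, (∑' u, (if (∑ s ∈ Finset.range u, (if (x (s + 1)).2 then (1 : ℕ) else 0)) = k * (m + 1) + i + 1 then (1 : ℝ) else 0) * f (x u).1)) / (∑ i ∈ Finset.range m, (∑' u, (if (∑ s ∈ Finset.range u, (if (x (s + 1)).2 then (1 : ℕ) else 0)) = k * (m + 1) + i + 1 then (1 : ℝ) else 0))) ≤ M x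
        then (1 : ℝ) else 0)) :
    (Kernel.trajMeasure (X := fun _ : ℕ => Ω × Bool) μs
        (fun n : ℕ => κs.comap (fun h : (i : ↥(Finset.Iic n)) → Ω × Bool =>
          h ⟨n, Finset.mem_Iic.2 le_rfl⟩) (measurable_pi_apply _))).real
      {x | s ≤ |M x - ∫ z, f z ∂π|}
      ≤ (2 * Real.sqrt (4 * (ε.toReal * ((∫ y, (f y - ∫ z, f z ∂π) ^ 2 ∂π)
          + 2 * ∑' k, ∫ y, (f y - ∫ z, f z ∂π) * (kop κ)^[k + 1] (fun y => f y - ∫ z, f z ∂π) y ∂π) / s ^ 2 + (1 - ε.toReal)) / m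
          * (1 - 4 * (ε.toReal * ((∫ y, (f y - ∫ z, f z ∂π) ^ 2 ∂π)
          + 2 * ∑' k, ∫ y, (f y - ∫ z, f z ∂π) * (kop κ)^[k + 1] (fun y => f y - ∫ z, f z ∂π) y ∂π) / s ^ 2 + (1 - ε.toReal)) / m))) ^ K := by
  set P := (Kernel.trajMeasure (X := fun _ : ℕ => Ω × Bool) μs
        (fun n : ℕ => κs.comap (fun h : (i : ↥(Finset.Iic n)) → Ω × Bool =>
          h ⟨n, Finset.mem_Iic.2 le_rfl⟩) (measurable_pi_apply _))) with hP
  have h := regenerative_medianOfGroups_chernoff_sigma κs μs (κ := κ) (ν := ν) (hmin := hmin) hπ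
    hε0 hε hκs hf hC hm hs hq K
  rw [← hP] at h
  have h1 := measureReal_median_far_le P
    (fun (k : ℕ) (x : ℕ → Ω × Bool) => (∑ i ∈ Finset.range m, (∑' u, (if (∑ s ∈ Finset.range u, (if (x (s + 1)).2 then (1 : ℕ) else 0)) = k * (m + 1) + i + 1 then (1 : ℝ) else 0) * f (x u).1)) / (∑ i ∈ Finset.range m, (∑' u, (if (∑ s ∈ Finset.range u, (if (x (s + 1)).2 then (1 : ℕ) else 0)) = k * (m + 1) + i + 1 then (1 : ℝ) else 0))))
    M K (∫ z, f z ∂π) s hlo hhi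
  exact h1.trans h

end ChernoffSigma

end Summit.Ventures.LatticeQCDFlow.Scoring

end
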